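import Mathlib
import Literature.MathematicalPhysics.QuantumFieldTheory.Balaban1983to89.B6TorusWindowChart
import Literature.MathematicalPhysics.QuantumFieldTheory.Balaban1983to89.B4PartitionUnity22

/-!
# `Balaban1983to89.B6TorusCutoffChi` — T. Bałaban, *Propagators and renormalization transformations for lattice gauge theories. II*,
Commun. Math. Phys. **96** (1984) 223–250 [Balaban1984PropagatorsII]: **a smooth scale-`M` cut-off `χ` on the fine torus `T_η = Site P 0` of the
one-scale tower family, with the printed sizes `|∂^ηχ| ≤ O(M⁻¹)`, `|Δ^ηχ| ≤ O(M⁻²)` UNIFORM IN THE MESH** — the function of the type of the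
print's `h_□`/`ζ_□` (p. 239: *"The function ζ_□ is of the same type as h_□, but it is equal to 1 on a cube containing □ … and it is equal to 0
outside a similar cube"*), built from the tree's `C₀^∞` profile `B4PartitionUnity22.thetaProf` in the window chart of `…B6TorusWindowChart`

statement-level skeleton of published theorems with citation tags; proofs where landed; nothing here is a claim about the Yang–Mills mass gap

Phase-2 PROOF SEAT p01 (gen 8) of the cell `lit-balaban` (HOME `run/shared/lean/pub/lit-balaban/`), free-target protocol G.5-34(d), own lane;
file 2 of the programme «the MODIFIED prescription of (2.70) with `G′(□̃)` on the torus `T_□̃` and the p. 238 change-of-domain sentence,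
genuine» — `χ` is the cut-off of the b2b line-3 chain `B6DomainMajorant.line3_core_majorant` / `B6Prop23DomainInput.hdom_of_line3` (core
`{χ = 1}` ⊇ □ ∪ supp h_□, zone = where χ varies).  Sources read as page images: `run/shared/lean/pub/pub-balaban/b2b-balaban-ref1/pages/
1984-cmp96-propagators-rt-II/1984-cmp96-propagators-rt-II-p007-x2.png` (p. 229), `…-p008-x2.png` (p. 230), `…-p017-x2.png` (p. 239); [B5] =
*… I*, CMP **95** (1984), (1.118) p. 36; [3] = [Balaban1983RegularityDecay] p. 577 *"|∂^ηh_j| ≤ O(M⁻¹), |Δ^ηh_j| ≤ O(M⁻²)"* (the tree's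
`B4PartitionUnity22.abs_thetaCube_diff_le` / `abs_thetaCube_second_diff_le`, `D1`, `D2`).

WHAT THIS FILE PROVES (kernel-checked, 0 sorry, axioms standard).  For a unit corner `c : Site P K`, a centre coordinate `H` and a radius `M ≥ 1`
under the chart hypotheses `7M + 4 ≤ 4H`, `4H + 7M + 8 ≤ 4N_K` (the support stays off the chart seam): `chiCut c H M x =
Π_μ θ((woff(x)_μ − c_f)/(2ML^K))`, `c_f = L^K·H + (L^K−1)/2` — `0 ≤ χ ≤ 1` (`chiCut_mem_Icc`); `χ = 1` on every fine site of a CORE block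
(`Core c H M = {y : 2(|woff(y)_μ − H| + 1) ≤ 3M ∀μ}`) AND at its fine neighbours (`chiCut_eq_one_near_core`); `χ = 0` on blocks with `4|woff(y)_μ − H|
≥ 7M + 2` (`chiCut_eq_zero_of_far`); **`|χ(x + e_μ) − χ(x)| ≤ D1θ/(2ML^K)`** per fine step (`abs_chiCut_shift_sub_le`), **`|χ(x+e_μ) − 2χ(x) +
χ(x−e_μ)| ≤ D2θ/(2ML^K)²`** (`abs_chiCut_second_diff_le`, summed `abs_sum_chiCut_second_diff_le`), in-block oscillation `≤ d·D1θ·(L^K−1)/(2ML^K)`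
(`abs_chiCut_sub_le_of_blk_eq`) — the η-derivative and η-Laplacian of `χ` are `O(M⁻¹)`, `O(M⁻²)` uniformly in `η = L^{−K}`.

HONEST SCOPE.  The profile is the tree's `thetaProf` (plateau `|t| ≤ ¾`, support `|t| < ⅞`), in window coordinates, corner-anchored blocks; the
constants are the abstract sup-norms `D1 thetaProf`, `D2 thetaProf`.  Bookkeeping for the siblings; NOT summit progress.
-/

namespace Literature.MathematicalPhysics.QuantumFieldTheory.Balaban1983to89.B6TorusCutoffChi

open Finset
open B1RG242Torus (lvl lvl_of_le sitesPerDir_zero_eq)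
open B5Ineq137Torus (blk blk_val fine fine_val)
open B4PartitionUnity22 (thetaProf thetaCube D1 D2 thetaProf_nonneg thetaProf_le_one contDiff_thetaProf hasCompactSupport_thetaProf
  thetaCube_mem_Icc thetaCube_eq_one thetaCube_eq_zero abs_thetaCube_diff_le abs_thetaCube_second_diff_le D1_nonneg D2_nonneg abs_sub_le_D1)
open B6TorusWindowChart
open B10StarCount (shift_unshift unshift_shift)

noncomputable section

variable (P : Params)

variable {P}

/-! ## §2  The smooth scale-`M` cut-off `χ` on the fine torus (the printed sizes `|∂^ηh| ≤ O(M⁻¹)`, `|Δ^ηh| ≤ O(M⁻²)`) -/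

section Cutoff

variable (P)

/-- the fine centre of the window chart with unit centre coordinate `H`: `c_f = L^K·H + (L^K − 1)/2` (the middle of the central unit block,
in fine chart coordinates). [cite: Balaban1984PropagatorsII, p.235 («a second cube □̃ containing □ in the middle»); bookkeeping] -/
def cf (H : ℕ) : ℝ := (P.L : ℝ) ^ P.K * H + ((P.L : ℝ) ^ P.K - 1) / 2

/-- the cut-off scale in fine units: `N_χ = 2M·L^K` (= `2M` unit blocks; plateau radius `¾N_χ = 1.5M`, support radius `⅞N_χ = 1.75M` blocks).
[cite: Balaban1984PropagatorsI, (1.118) p.36; bookkeeping] -/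
def Nchi (M : ℕ) : ℝ := 2 * M * (P.L : ℝ) ^ P.K

/-- the centred fine chart vector of a site: `v(x)_μ = woff(x)_μ − c_f`. [cite: Balaban1984PropagatorsII, p.238; bookkeeping] -/
def cvec (c : Site P P.K) (H : ℕ) (x : Site P 0) : Fin P.d → ℝ := fun μ => (woff P 0 (fine P P.K c) x μ : ℝ) - cf P H

/-- **THE CUT-OFF `χ`** of scale `M` centred at the unit site of chart coordinate `(H,…,H)`: `χ(x) = Π_μ θ((woff(x)_μ − c_f)/(2ML^K))` with
the tree's `C₀^∞` profile `θ = B4PartitionUnity22.thetaProf` (`θ = 1` on `|t| ≤ ¾`, `θ = 0` on `|t| ≥ ⅞`) — a smooth characteristic function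
of the cube of radius `1.5M` blocks, vanishing outside radius `1.75M`, of the type of the printed `h_□`/`ζ_□` (*"The function ζ_□ is of the
same type as h_□, but it is equal to 1 on a cube containing □ …"*, p. 239). [cite: Balaban1984PropagatorsII, p.239 (ζ_□); Balaban1984PropagatorsI, (1.118) p.36] -/
def chiCut (c : Site P P.K) (H M : ℕ) (x : Site P 0) : ℝ := thetaCube (Nchi P M) (0 : Fin P.d → ℤ) (cvec P c H x)

/-- **the core**: the unit sites `y` with `2(|woff(y)_μ − H| + 1) ≤ 3M` for all `μ` (the cube of radius `1.5M − 1` about the centre) — on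
its blocks and their neighbours `χ = 1`. [cite: Balaban1984PropagatorsII, p.239 («equal to 1 on a cube containing □»); bookkeeping] -/
def Core (c : Site P P.K) (H M : ℕ) : Finset (Site P P.K) :=
  Finset.univ.filter fun y => ∀ μ, 2 * (|(woff P P.K c y μ : ℤ) - H| + 1) ≤ 3 * M

variable {P}

/-- `0 ≤ χ ≤ 1`. [cite: Balaban1984PropagatorsI, (1.118) p.36] -/
theorem chiCut_mem_Icc (c : Site P P.K) (H M : ℕ) (x : Site P 0) : chiCut P c H M x ∈ Set.Icc (0 : ℝ) 1 :=
  thetaCube_mem_Icc _ _ _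

/-- `|χ| ≤ 1`. [cite: Balaban1984PropagatorsI, (1.118) p.36] -/
theorem abs_chiCut_le_one (c : Site P P.K) (H M : ℕ) (x : Site P 0) : |chiCut P c H M x| ≤ 1 := by
  have h := chiCut_mem_Icc c H M x
  rw [abs_of_nonneg h.1]; exact h.2

/-- `N_χ > 0` for `M ≥ 1`. [cite: Balaban1984PropagatorsI, (1.118) p.36; bookkeeping] -/
theorem Nchi_pos {M : ℕ} (hM : 1 ≤ M) : 0 < Nchi P M := by
  unfold Nchi
  have : (0 : ℝ) < P.L := P.cast_L_pos
  have hM' : (1 : ℝ) ≤ M := by exact_mod_cast hM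
  positivity

/-- plateau: `|v(x)_μ| ≤ ¾N_χ` for all `μ` ⇒ `χ(x) = 1`. [cite: Balaban1984PropagatorsI, (1.118) p.36] -/
theorem chiCut_eq_one {M : ℕ} (hM : 1 ≤ M) {c : Site P P.K} {H : ℕ} {x : Site P 0}
    (h : ∀ μ, |cvec P c H x μ| ≤ 3 / 4 * Nchi P M) : chiCut P c H M x = 1 := by
  unfold chiCut
  refine thetaCube_eq_one (Nchi_pos hM) fun μ => ?_
  simpa using h μ

/-- support: `⅞N_χ ≤ |v(x)_μ|` for some `μ` ⇒ `χ(x) = 0`. [cite: Balaban1984PropagatorsI, (1.118) p.36] -/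
theorem chiCut_eq_zero {M : ℕ} (hM : 1 ≤ M) {c : Site P P.K} {H : ℕ} {x : Site P 0} {μ : Fin P.d}
    (h : 7 / 8 * Nchi P M ≤ |cvec P c H x μ|) : chiCut P c H M x = 0 := by
  unfold chiCut
  refine thetaCube_eq_zero (Nchi_pos hM) (μ := μ) ?_
  simpa using h

/-- the centred chart coordinate of a fine site against the unit chart coordinate of its block:
`L^K|u − H| − (L^K−1)/2 ≤ |v(x)_μ| ≤ L^K|u − H| + (L^K−1)/2`, `u = woff(blk x)_μ`. [cite: Balaban1984PropagatorsII, (2.1) p.224; bookkeeping] -/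
theorem abs_cvec_bounds (c : Site P P.K) (H : ℕ) (x : Site P 0) (μ : Fin P.d) :
    (P.L : ℝ) ^ P.K * |((woff P P.K c (blk P P.K x) μ : ℤ) : ℝ) - H| - ((P.L : ℝ) ^ P.K - 1) / 2 ≤ |cvec P c H x μ| ∧
      |cvec P c H x μ| ≤ (P.L : ℝ) ^ P.K * |((woff P P.K c (blk P P.K x) μ : ℤ) : ℝ) - H| + ((P.L : ℝ) ^ P.K - 1) / 2 := by
  have hmem := woff_fine_mem c x μ
  set n := P.L ^ P.K with hn
  set u := woff P P.K c (blk P P.K x) μ with hu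
  set w := woff P 0 (fine P P.K c) x μ with hw
  have hn1 : 1 ≤ n := Nat.one_le_iff_ne_zero.mpr (pow_pos P.L_pos _).ne'
  have hnR : ((n : ℕ) : ℝ) = (P.L : ℝ) ^ P.K := by rw [hn]; push_cast; rfl
  have e : cvec P c H x μ = (P.L : ℝ) ^ P.K * (((u : ℤ) : ℝ) - H) + ((w : ℝ) - n * u - ((P.L : ℝ) ^ P.K - 1) / 2) := by
    unfold cvec cf
    rw [← hnR]; push_cast; ring
  have hr0 : (0 : ℝ) ≤ (w : ℝ) - n * u := by
    have : ((n * u : ℕ) : ℝ) ≤ w := by exact_mod_cast hmem.1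
    push_cast at this; linarith
  have hr1 : (w : ℝ) - n * u ≤ (n : ℝ) - 1 := by
    have : ((w + 1 : ℕ) : ℝ) ≤ ((n * u + n : ℕ) : ℝ) := by exact_mod_cast hmem.2
    push_cast at this; linarith
  have hnR1 : (1 : ℝ) ≤ (P.L : ℝ) ^ P.K := by rw [← hnR]; exact_mod_cast hn1
  have habs : |(w : ℝ) - n * u - ((P.L : ℝ) ^ P.K - 1) / 2| ≤ ((P.L : ℝ) ^ P.K - 1) / 2 := by
    rw [← hnR] at *; rw [abs_le]; constructor <;> linarith
  rw [e]
  constructor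
  · have h := abs_sub_abs_le_abs_sub ((P.L : ℝ) ^ P.K * (((u : ℤ) : ℝ) - H)) (-((w : ℝ) - n * u - ((P.L : ℝ) ^ P.K - 1) / 2))
    rw [sub_neg_eq_add, abs_neg, abs_mul, abs_of_pos (by linarith : (0 : ℝ) < (P.L : ℝ) ^ P.K)] at h
    linarith
  · have h := abs_add_le ((P.L : ℝ) ^ P.K * (((u : ℤ) : ℝ) - H)) ((w : ℝ) - n * u - ((P.L : ℝ) ^ P.K - 1) / 2)
    rw [abs_mul, abs_of_pos (by linarith : (0 : ℝ) < (P.L : ℝ) ^ P.K)] at h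
    linarith

/-- **`χ = 0` far away**: on every block `y` with `7M + 2 ≤ 4|woff(y)_μ − H|` for some `μ`, the cut-off vanishes.
[cite: Balaban1984PropagatorsI, (1.118) p.36 («h ∈ C₀^∞(]−⅔, ⅔[)»)] -/
theorem chiCut_eq_zero_of_far {M : ℕ} (hM : 1 ≤ M) {c : Site P P.K} {H : ℕ} {x : Site P 0} {μ : Fin P.d}
    (hfar : 7 * (M : ℤ) + 2 ≤ 4 * |(woff P P.K c (blk P P.K x) μ : ℤ) - H|) : chiCut P c H M x = 0 := by
  refine chiCut_eq_zero hM (μ := μ) ?_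
  have hlo := (abs_cvec_bounds c H x μ).1
  have hn1 : (1 : ℝ) ≤ (P.L : ℝ) ^ P.K := one_le_pow₀ (by exact_mod_cast P.hL.2.le)
  have hfar' : 7 * (M : ℝ) + 2 ≤ 4 * |((woff P P.K c (blk P P.K x) μ : ℤ) : ℝ) - H| := by
    have : ((7 * (M : ℤ) + 2 : ℤ) : ℝ) ≤ ((4 * |(woff P P.K c (blk P P.K x) μ : ℤ) - H| : ℤ) : ℝ) := by exact_mod_cast hfar
    push_cast at this
    simpa [Int.cast_abs] using this
  unfold Nchi
  nlinarith

/-- the chart coordinates of the sites of a core block are far from both seams: `1 ≤ woff(x)_μ` and `woff(x)_μ + 2 ≤ N₀`.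
[cite: Balaban1984PropagatorsII, p.238; bookkeeping] -/
theorem woff_core_bounds {M : ℕ} {c : Site P P.K} {H : ℕ} (hH : 7 * M + 4 ≤ 4 * H) (hN : 4 * H + 7 * M + 8 ≤ 4 * P.sitesPerDir P.K)
    {x : Site P 0} (hx : blk P P.K x ∈ Core P c H M) (μ : Fin P.d) :
    1 ≤ woff P 0 (fine P P.K c) x μ ∧ woff P 0 (fine P P.K c) x μ + 2 ≤ P.sitesPerDir 0 := by
  have hKle : P.K ≤ P.m + P.K := Nat.le_add_left _ _
  have hN0 : P.sitesPerDir 0 = P.L ^ P.K * P.sitesPerDir P.K := by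
    have := sitesPerDir_zero_eq P P.K; rwa [lvl_of_le P hKle] at this
  have hmem := woff_fine_mem c x μ
  have hcore := (Finset.mem_filter.mp hx).2 μ
  set n := P.L ^ P.K with hn
  set u := woff P P.K c (blk P P.K x) μ with hu
  have hn1 : 1 ≤ n := Nat.one_le_iff_ne_zero.mpr (pow_pos P.L_pos _).ne'
  have hu1 : 1 ≤ u := by zify at hcore ⊢; cases abs_cases ((u : ℤ) - H) <;> omega
  have hu2 : u + 2 ≤ P.sitesPerDir P.K := by zify at hcore ⊢; cases abs_cases ((u : ℤ) - H) <;> omega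
  have hnu : 0 < n * u := Nat.mul_pos (by omega) (by omega)
  constructor
  · exact le_trans hnu hmem.1
  · rw [hN0]; nlinarith [hmem.2]

/-- the real form of the chart hypotheses: the support radius `⅞N_χ` fits below the centre minus one and below the top seam minus two.
[cite: Balaban1984PropagatorsII, p.235 («of the size 4M … □ in the middle»); bookkeeping] -/
theorem seam_bounds {M : ℕ} {H : ℕ} (hH : 7 * M + 4 ≤ 4 * H) (hN : 4 * H + 7 * M + 8 ≤ 4 * P.sitesPerDir P.K) :
    7 / 8 * Nchi P M ≤ cf P H - 1 ∧ 7 / 8 * Nchi P M ≤ (P.sitesPerDir 0 : ℝ) - 2 - cf P H := by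
  have hKle : P.K ≤ P.m + P.K := Nat.le_add_left _ _
  have hN0 : P.sitesPerDir 0 = P.L ^ P.K * P.sitesPerDir P.K := by
    have := sitesPerDir_zero_eq P P.K; rwa [lvl_of_le P hKle] at this
  have hn1 : (1 : ℝ) ≤ (P.L : ℝ) ^ P.K := one_le_pow₀ (by exact_mod_cast P.hL.2.le)
  have hH' : 7 * (M : ℝ) + 4 ≤ 4 * H := by exact_mod_cast hH
  have hN' : 4 * (H : ℝ) + 7 * M + 8 ≤ 4 * (P.sitesPerDir P.K : ℝ) := by exact_mod_cast hN
  have hN0' : (P.sitesPerDir 0 : ℝ) = (P.L : ℝ) ^ P.K * (P.sitesPerDir P.K : ℝ) := by rw [hN0]; push_cast; ring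
  unfold Nchi cf
  rw [hN0']
  constructor <;> nlinarith

/-- **`χ = 1` on the core and next to it**: for a fine site `x` of a core block, `χ(x) = χ(x ± e_ν) = 1` for every direction `ν` — the
plateau *"equal to 1 on a cube containing □"* reaches one fine step (and one block, `chiCut` being constant… no: being `1`) beyond the core.
[cite: Balaban1984PropagatorsII, p.239 (ζ_□ «equal to 1 on a cube containing □»); Balaban1984PropagatorsI, (1.118) p.36] -/
theorem chiCut_eq_one_near_core {M : ℕ} (hM : 1 ≤ M) {c : Site P P.K} {H : ℕ} (hH : 7 * M + 4 ≤ 4 * H)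
    (hN : 4 * H + 7 * M + 8 ≤ 4 * P.sitesPerDir P.K) {x : Site P 0} (hx : blk P P.K x ∈ Core P c H M) :
    chiCut P c H M x = 1 ∧ ∀ ν, chiCut P c H M (x.shift ν) = 1 ∧ chiCut P c H M (x.unshift ν) = 1 := by
  have hn1 : (1 : ℝ) ≤ (P.L : ℝ) ^ P.K := one_le_pow₀ (by exact_mod_cast P.hL.2.le)
  have hcore : ∀ μ, 2 * (|(woff P P.K c (blk P P.K x) μ : ℤ) - H| + 1) ≤ 3 * M := (Finset.mem_filter.mp hx).2
  -- every coordinate of v(x) is within ¾N_χ − 1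
  have key : ∀ μ, |cvec P c H x μ| ≤ 3 / 4 * Nchi P M - 1 := by
    intro μ
    have hup := (abs_cvec_bounds c H x μ).2
    have hc : 2 * (|((woff P P.K c (blk P P.K x) μ : ℤ) : ℝ) - H| + 1) ≤ 3 * M := by
      have : ((2 * (|(woff P P.K c (blk P P.K x) μ : ℤ) - H| + 1) : ℤ) : ℝ) ≤ ((3 * M : ℤ) : ℝ) := by exact_mod_cast hcore μ
      push_cast at this; simpa [Int.cast_abs] using this
    unfold Nchi
    nlinarith [abs_nonneg (((woff P P.K c (blk P P.K x) μ : ℤ) : ℝ) - H)]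
  have hw := woff_core_bounds hH hN hx
  refine ⟨chiCut_eq_one hM fun μ => (key μ).trans (by linarith), fun ν => ⟨?_, ?_⟩⟩
  · refine chiCut_eq_one hM fun μ => ?_
    by_cases hμ : μ = ν
    · subst hμ
      have e : cvec P c H (x.shift μ) μ = cvec P c H x μ + 1 := by
        unfold cvec; rw [woff_shift_of_lt 0 _ x μ (by have := (hw μ).2; omega)]; push_cast; ring
      rw [e]
      calc |cvec P c H x μ + 1| ≤ |cvec P c H x μ| + |1| := abs_add_le _ _
        _ ≤ 3 / 4 * Nchi P M := by rw [abs_one]; linarith [key μ]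
    · have e : cvec P c H (x.shift ν) μ = cvec P c H x μ := by unfold cvec; rw [woff_shift_ne 0 _ x hμ]
      rw [e]; exact (key μ).trans (by linarith)
  · refine chiCut_eq_one hM fun μ => ?_
    by_cases hμ : μ = ν
    · subst hμ
      have e : cvec P c H (x.unshift μ) μ = cvec P c H x μ - 1 := by
        unfold cvec; rw [woff_unshift_of_pos 0 _ x μ (hw μ).1, Nat.cast_sub (hw μ).1]; push_cast; ring
      rw [e]
      calc |cvec P c H x μ - 1| ≤ |cvec P c H x μ| + |1| := abs_sub _ _
        _ ≤ 3 / 4 * Nchi P M := by rw [abs_one]; linarith [key μ]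
    · have e : cvec P c H (x.unshift ν) μ = cvec P c H x μ := by unfold cvec; rw [woff_unshift_ne 0 _ x hμ]
      rw [e]; exact (key μ).trans (by linarith)

/-- **`|∂^η_μχ| ≤ O(M⁻¹)` per fine step**: `|χ(x + e_μ) − χ(x)| ≤ D1θ/N_χ = D1θ/(2ML^K)`, uniformly in the mesh (across the chart seam both
values vanish). [cite: Balaban1983RegularityDecay, §2 p.577 («|∂^ηh_j| ≤ O(M⁻¹)»); Balaban1984PropagatorsII, (2.40) p.230] -/
theorem abs_chiCut_shift_sub_le {M : ℕ} (hM : 1 ≤ M) {c : Site P P.K} {H : ℕ} (hH : 7 * M + 4 ≤ 4 * H)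
    (hN : 4 * H + 7 * M + 8 ≤ 4 * P.sitesPerDir P.K) (x : Site P 0) (μ : Fin P.d) :
    |chiCut P c H M (x.shift μ) - chiCut P c H M x| ≤ D1 thetaProf / Nchi P M := by
  have hNχ := Nchi_pos (P := P) hM
  have hsb := seam_bounds (P := P) hH hN
  rcases Nat.lt_or_ge (woff P 0 (fine P P.K c) x μ + 1) (P.sitesPerDir 0) with hlt | hge
  · -- no wrap: the shift is the coordinate update v ↦ v + e_μ
    have e : cvec P c H (x.shift μ) = Function.update (cvec P c H x) μ (cvec P c H x μ + 1) := by
      funext ν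
      by_cases hν : ν = μ
      · subst hν; rw [Function.update_self]; unfold cvec; rw [woff_shift_of_lt 0 _ x ν hlt]; push_cast; ring
      · rw [Function.update_of_ne hν]; unfold cvec; rw [woff_shift_ne 0 _ x hν]
    unfold chiCut; rw [e]
    have h := abs_thetaCube_diff_le hNχ (0 : Fin P.d → ℤ) (cvec P c H x) μ 1
    rwa [abs_one, mul_one] at h
  · -- wrap: x sits on the top seam, x + e_μ on the bottom seam; both cut-off values vanish
    have hw : woff P 0 (fine P P.K c) x μ + 1 = P.sitesPerDir 0 := le_antisymm (woff_lt 0 _ x μ) hge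
    have hx0 : chiCut P c H M x = 0 := by
      refine chiCut_eq_zero hM (μ := μ) ?_
      have : cvec P c H x μ = (P.sitesPerDir 0 : ℝ) - 1 - cf P H := by
        unfold cvec
        have : ((woff P 0 (fine P P.K c) x μ : ℕ) : ℝ) = (P.sitesPerDir 0 : ℝ) - 1 := by
          have : ((woff P 0 (fine P P.K c) x μ + 1 : ℕ) : ℝ) = (P.sitesPerDir 0 : ℝ) := by exact_mod_cast hw
          push_cast at this; linarith
        rw [this]
      rw [this, abs_of_nonneg (by linarith)]; linarith
    have hx1 : chiCut P c H M (x.shift μ) = 0 := by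
      refine chiCut_eq_zero hM (μ := μ) ?_
      have : cvec P c H (x.shift μ) μ = -cf P H := by
        unfold cvec; rw [woff_shift_self, hw, Nat.mod_self]; push_cast; ring
      rw [this, abs_neg, abs_of_nonneg (by linarith)]; linarith
    rw [hx0, hx1, sub_zero, abs_zero]
    exact div_nonneg (D1_nonneg contDiff_thetaProf hasCompactSupport_thetaProf) hNχ.le

/-- **`|Δ^ηχ| ≤ O(M⁻²)` per direction**: `|χ(x + e_μ) − 2χ(x) + χ(x − e_μ)| ≤ D2θ/N_χ²`, uniformly in the mesh (at the chart seam all three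
values vanish). [cite: Balaban1983RegularityDecay, §2 p.577 («|Δ^ηh_j| ≤ O(M⁻²)»); Balaban1984PropagatorsII, (2.40) p.230] -/
theorem abs_chiCut_second_diff_le {M : ℕ} (hM : 1 ≤ M) {c : Site P P.K} {H : ℕ} (hH : 7 * M + 4 ≤ 4 * H)
    (hN : 4 * H + 7 * M + 8 ≤ 4 * P.sitesPerDir P.K) (x : Site P 0) (μ : Fin P.d) :
    |chiCut P c H M (x.shift μ) - 2 * chiCut P c H M x + chiCut P c H M (x.unshift μ)| ≤ D2 thetaProf / Nchi P M ^ 2 := by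
  have hNχ := Nchi_pos (P := P) hM
  have hsb := seam_bounds (P := P) hH hN
  set w := woff P 0 (fine P P.K c) x μ with hwdef
  by_cases hint : 1 ≤ w ∧ w + 1 < P.sitesPerDir 0
  · -- interior: both shifts are coordinate updates
    have e1 : cvec P c H (x.shift μ) = Function.update (cvec P c H x) μ (cvec P c H x μ + 1) := by
      funext ν
      by_cases hν : ν = μ
      · subst hν; rw [Function.update_self]; unfold cvec; rw [woff_shift_of_lt 0 _ x ν hint.2]; push_cast; ring
      · rw [Function.update_of_ne hν]; unfold cvec; rw [woff_shift_ne 0 _ x hν]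
    have e2 : cvec P c H (x.unshift μ) = Function.update (cvec P c H x) μ (cvec P c H x μ - 1) := by
      funext ν
      by_cases hν : ν = μ
      · subst hν; rw [Function.update_self]; unfold cvec
        rw [woff_unshift_of_pos 0 _ x ν hint.1, Nat.cast_sub hint.1]; push_cast; ring
      · rw [Function.update_of_ne hν]; unfold cvec; rw [woff_unshift_ne 0 _ x hν]
    unfold chiCut; rw [e1, e2]
    have h := abs_thetaCube_second_diff_le (Nchi P M) (0 : Fin P.d → ℤ) (cvec P c H x) μ 1
    rwa [one_pow, mul_one] at h
  · -- seam: w = 0 or w = N₀ − 1; all three values vanish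
    have hwlt := woff_lt 0 (fine P P.K c) x μ
    have hcases : w = 0 ∨ w + 1 = P.sitesPerDir 0 := by omega
    have hN0R : ((P.sitesPerDir 0 : ℕ) : ℝ) = (P.sitesPerDir 0 : ℝ) := rfl
    -- the value at a site whose μ-chart coordinate is 0, 1, N₀−1 or N₀−2 vanishes
    have vanish : ∀ z : Site P 0, (woff P 0 (fine P P.K c) z μ = 0 ∨ woff P 0 (fine P P.K c) z μ = 1 ∨
        woff P 0 (fine P P.K c) z μ + 1 = P.sitesPerDir 0 ∨ woff P 0 (fine P P.K c) z μ + 2 = P.sitesPerDir 0) →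
        chiCut P c H M z = 0 := by
      intro z hz
      refine chiCut_eq_zero hM (μ := μ) ?_
      unfold cvec
      rcases hz with h | h | h | h
      · rw [h]; push_cast; rw [zero_sub, abs_neg, abs_of_nonneg (by linarith)]; linarith
      · rw [h]; push_cast; rw [abs_of_nonpos (by linarith)]; linarith
      · have : ((woff P 0 (fine P P.K c) z μ : ℕ) : ℝ) = (P.sitesPerDir 0 : ℝ) - 1 := by
          have : ((woff P 0 (fine P P.K c) z μ + 1 : ℕ) : ℝ) = (P.sitesPerDir 0 : ℝ) := by exact_mod_cast h
          push_cast at this; linarith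
        rw [this, abs_of_nonneg (by linarith)]; linarith
      · have : ((woff P 0 (fine P P.K c) z μ : ℕ) : ℝ) = (P.sitesPerDir 0 : ℝ) - 2 := by
          have : ((woff P 0 (fine P P.K c) z μ + 2 : ℕ) : ℝ) = (P.sitesPerDir 0 : ℝ) := by exact_mod_cast h
          push_cast at this; linarith
        rw [this, abs_of_nonneg (by linarith)]; linarith
    have h2N : 2 ≤ P.sitesPerDir 0 := (P.one_lt_sitesPerDir 0)
    have hx0 : chiCut P c H M x = 0 := vanish x (by rcases hcases with h | h; exact Or.inl h; exact Or.inr (Or.inr (Or.inl h)))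
    have hxs : chiCut P c H M (x.shift μ) = 0 := by
      apply vanish
      rw [woff_shift_self, ← hwdef]
      rcases hcases with h | h
      · rw [h, zero_add, Nat.mod_eq_of_lt (by omega)]; exact Or.inr (Or.inl rfl)
      · rw [h, Nat.mod_self]; exact Or.inl rfl
    have hxu : chiCut P c H M (x.unshift μ) = 0 := by
      apply vanish
      have hu := woff_unshift_self 0 (fine P P.K c) x μ
      rw [← hwdef] at hu
      have hult := woff_lt 0 (fine P P.K c) (x.unshift μ) μ
      set w' := woff P 0 (fine P P.K c) (x.unshift μ) μ with hw'
      rcases hcases with h | h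
      · -- w = 0 ⇒ w' + 1 = N₀
        rcases Nat.lt_or_ge (w' + 1) (P.sitesPerDir 0) with h1 | h1
        · rw [Nat.mod_eq_of_lt h1] at hu; omega
        · exact Or.inr (Or.inr (Or.inl (by omega)))
      · -- w = N₀ − 1 ⇒ w' = N₀ − 2
        rcases Nat.lt_or_ge (w' + 1) (P.sitesPerDir 0) with h1 | h1
        · rw [Nat.mod_eq_of_lt h1] at hu; exact Or.inr (Or.inr (Or.inr (by omega)))
        · have : w' + 1 = P.sitesPerDir 0 := by omega
          rw [this, Nat.mod_self] at hu; omega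
    rw [hx0, hxs, hxu]
    norm_num
    exact div_nonneg (D2_nonneg contDiff_thetaProf hasCompactSupport_thetaProf) (sq_nonneg _)

/-- **`|Δ^ηχ| ≤ O(M⁻²)`, summed over the directions**: `|Σ_μ (χ(x + e_μ) − 2χ(x) + χ(x − e_μ))| ≤ d·D2θ/N_χ²`.
[cite: Balaban1983RegularityDecay, §2 p.577 («|Δ^ηh_j| ≤ O(M⁻²)»)] -/
theorem abs_sum_chiCut_second_diff_le {M : ℕ} (hM : 1 ≤ M) {c : Site P P.K} {H : ℕ} (hH : 7 * M + 4 ≤ 4 * H)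
    (hN : 4 * H + 7 * M + 8 ≤ 4 * P.sitesPerDir P.K) (x : Site P 0) :
    |∑ μ, (chiCut P c H M (x.shift μ) - 2 * chiCut P c H M x + chiCut P c H M (x.unshift μ))| ≤
      P.d * (D2 thetaProf / Nchi P M ^ 2) := by
  calc |∑ μ, (chiCut P c H M (x.shift μ) - 2 * chiCut P c H M x + chiCut P c H M (x.unshift μ))|
      ≤ ∑ μ, |chiCut P c H M (x.shift μ) - 2 * chiCut P c H M x + chiCut P c H M (x.unshift μ)| := Finset.abs_sum_le_sum_abs _ _
    _ ≤ ∑ _μ : Fin P.d, D2 thetaProf / Nchi P M ^ 2 := Finset.sum_le_sum fun μ _ => abs_chiCut_second_diff_le hM hH hN x μ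
    _ = P.d * (D2 thetaProf / Nchi P M ^ 2) := by rw [Finset.sum_const, Finset.card_univ, Fintype.card_fin, nsmul_eq_mul]

/-- `|Π_i a_i − Π_i b_i| ≤ Σ_i |a_i − b_i|` for factors in `[0, 1]` (re-proved; the tree's copy lives in `…B6CoverBox`, not imported here). [folklore] -/
private theorem abs_prod_sub_prod_le {ι : Type*} (s : Finset ι) {f g : ι → ℝ} (hf : ∀ i, 0 ≤ f i ∧ f i ≤ 1)
    (hg : ∀ i, 0 ≤ g i ∧ g i ≤ 1) : |∏ i ∈ s, f i - ∏ i ∈ s, g i| ≤ ∑ i ∈ s, |f i - g i| := by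
  classical
  refine Finset.induction_on s ?_ ?_
  · simp
  · intro a s has ih
    rw [Finset.prod_insert has, Finset.prod_insert has, Finset.sum_insert has]
    have hQ0 : 0 ≤ ∏ i ∈ s, g i := Finset.prod_nonneg fun i _ => (hg i).1
    have hQ1 : ∏ i ∈ s, g i ≤ 1 := Finset.prod_le_one (fun i _ => (hg i).1) fun i _ => (hg i).2
    have hfa := hf a
    calc |f a * ∏ i ∈ s, f i - g a * ∏ i ∈ s, g i|
        = |f a * (∏ i ∈ s, f i - ∏ i ∈ s, g i) + (f a - g a) * ∏ i ∈ s, g i| := by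
          congr 1
          ring
      _ ≤ |f a * (∏ i ∈ s, f i - ∏ i ∈ s, g i)| + |(f a - g a) * ∏ i ∈ s, g i| := abs_add_le _ _
      _ = f a * |∏ i ∈ s, f i - ∏ i ∈ s, g i| + |f a - g a| * ∏ i ∈ s, g i := by
          rw [abs_mul, abs_mul, abs_of_nonneg hfa.1, abs_of_nonneg hQ0]
      _ ≤ 1 * (∑ i ∈ s, |f i - g i|) + |f a - g a| * 1 :=
          add_le_add (mul_le_mul hfa.2 ih (abs_nonneg _) zero_le_one)
            (mul_le_mul_of_nonneg_left hQ1 (abs_nonneg _))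
      _ = |f a - g a| + ∑ i ∈ s, |f i - g i| := by ring

/-- **in-block oscillation of `χ`**: block-mates `x`, `x′` (same unit block) satisfy `|χ(x) − χ(x′)| ≤ d·D1θ·(L^K − 1)/N_χ ≤ d·D1θ/(2M)` — the
content of `|(∂h)(Γ_{x,y(x),x′})| ≤ O(M⁻¹)` for the in-block contour of (2.39). [cite: Balaban1984PropagatorsII, (2.39)–(2.40) pp.229–230] -/
theorem abs_chiCut_sub_le_of_blk_eq {M : ℕ} (hM : 1 ≤ M) (c : Site P P.K) (H : ℕ) {x x' : Site P 0}
    (h : blk P P.K x = blk P P.K x') :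
    |chiCut P c H M x - chiCut P c H M x'| ≤ P.d * (D1 thetaProf * (((P.L : ℝ) ^ P.K - 1) / Nchi P M)) := by
  have hNχ := Nchi_pos (P := P) hM
  have hD1 := D1_nonneg contDiff_thetaProf hasCompactSupport_thetaProf
  have hθ01 : ∀ t, 0 ≤ thetaProf t ∧ thetaProf t ≤ 1 := fun t => ⟨thetaProf_nonneg t, thetaProf_le_one t⟩
  unfold chiCut thetaCube
  calc |∏ μ, thetaProf (cvec P c H x μ / Nchi P M - ((0 : Fin P.d → ℤ) μ : ℝ)) -
          ∏ μ, thetaProf (cvec P c H x' μ / Nchi P M - ((0 : Fin P.d → ℤ) μ : ℝ))|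
      ≤ ∑ μ, |thetaProf (cvec P c H x μ / Nchi P M - ((0 : Fin P.d → ℤ) μ : ℝ)) -
          thetaProf (cvec P c H x' μ / Nchi P M - ((0 : Fin P.d → ℤ) μ : ℝ))| :=
        abs_prod_sub_prod_le _ (fun μ => hθ01 _) (fun μ => hθ01 _)
    _ ≤ ∑ _μ : Fin P.d, D1 thetaProf * (((P.L : ℝ) ^ P.K - 1) / Nchi P M) := by
        refine Finset.sum_le_sum fun μ _ => ?_
        have h1 := abs_sub_le_D1 contDiff_thetaProf hasCompactSupport_thetaProf
          (cvec P c H x' μ / Nchi P M - ((0 : Fin P.d → ℤ) μ : ℝ)) (cvec P c H x μ / Nchi P M - ((0 : Fin P.d → ℤ) μ : ℝ))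
        refine h1.trans (mul_le_mul_of_nonneg_left ?_ hD1)
        have e : cvec P c H x μ / Nchi P M - ((0 : Fin P.d → ℤ) μ : ℝ) - (cvec P c H x' μ / Nchi P M - ((0 : Fin P.d → ℤ) μ : ℝ)) =
            (((woff P 0 (fine P P.K c) x μ : ℤ) : ℝ) - ((woff P 0 (fine P P.K c) x' μ : ℤ) : ℝ)) / Nchi P M := by
          unfold cvec; push_cast; ring
        rw [e, abs_div, abs_of_pos hNχ]
        refine div_le_div_of_nonneg_right ?_ hNχ.le
        have hb := abs_woff_sub_woff_le_of_blk_eq c h μ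
        have : ((|(woff P 0 (fine P P.K c) x μ : ℤ) - (woff P 0 (fine P P.K c) x' μ : ℤ)| : ℤ) : ℝ) ≤
            ((((P.L ^ P.K : ℕ) : ℤ) - 1 : ℤ) : ℝ) := by exact_mod_cast hb
        push_cast at this
        simpa [Int.cast_abs, Int.cast_sub] using this
    _ = P.d * (D1 thetaProf * (((P.L : ℝ) ^ P.K - 1) / Nchi P M)) := by
        rw [Finset.sum_const, Finset.card_univ, Fintype.card_fin, nsmul_eq_mul]

end Cutoff

end

end Literature.MathematicalPhysics.QuantumFieldTheory.Balaban1983to89.B6TorusCutoffChi
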